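import Summits.BirchSwinnertonDyer.BirchSwinnertonDyer.Theorems.KimAtThreeKolyvaginPortShared
import HarnessLib

/-!
# Crux `KatoKuriharaPortThreeShared` (stmt-BirchSwinnertonDyer-19560): the CERTIFICATE SUPPLY (C2)
# reduced to ONE unit minus modular symbol per row (cell `bsd-addord`, seat kim3 gen 10)

`Theorems/KimAtThreeKolyvaginPortShared.lean` (this seat, p448445) proves the crux BY NAME from three
displayed inputs; the second, (C2) CERTIFICATE SUPPLY, asks on every row of the Kato stratum for an
auxiliary cusp datum `(c, d, a, A, d′, aM)` of Kato's `a(A)`-type zeta elements meeting Kato's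
guards (`(c, 18A) = (d, 18N) = 1`), n1011's `hcdA` (no prime `≡ 1 (mod 3)` divides `2cdA`),
`(cd, A) = 1`, `dd′ ≡ 1 (A)`, `(A, N) = 1`, integer models `aM` of `a_q(f)` at `q ∣ 3A`, and the
two VALUE CERTIFICATES of ★ PK-6₂ ∘ T-PK6-VDIS: the Euler-factor product
`∏_{q ∣ 3A} (1 − a_q/q + [q ∤ N]/q)` and the four-term minus-symbol factor
`R⁻ = c²d²[a/A]⁻ − cd²[ac/A]⁻ − c²d[ad′/A]⁻ + cd[acd′/A]⁻` are non-zero `3`-adic units.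

THIS FILE (theorems only; 0 defs / 0 facts / 0 sorry) reduces (C2) at a row to a ONE-NUMBER
certificate: a prime `q ≡ 2 (mod 3)`, `q ∤ N`, with `3 ∤ q + 1 − a_q(f)` (`= #Ẽ(𝔽_q)` for
`q ∤ N`: a non-anomalous auxiliary prime), an exponent `n ≥ 1`, and ONE numerator `a₀` whose minus
modular symbol `[a₀/q^n]⁻_f` is a non-zero `3`-adic unit.  The construction (memo
KIM3-W2-PORT-g10 §R2): `A = q^n`, `a = a₀`, `d′ = 1`, and `c`, `d` PRIMES with `c ≡ d ≡ 1 (mod A)`,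
`c ≡ d ≡ 2 (mod 3)`, `c, d > 18AN` (Dirichlet's theorem in the progression `1 + A² (mod 3A)`,
Mathlib `Nat.forall_exists_prime_gt_and_zmodEq`); then `[ac/A]⁻ = [acd′/A]⁻ = [a/A]⁻` by
periodicity (`ratMinusSymbol_add_intCast`), so `R⁻ = cd(c − 1)(d − 1)·[a₀/A]⁻` — Kato's classical
factor (Rubin 1998 Cor. 7.2, Kim–Kim–Sun 2020 Thm. 7.3, Kim–Nakamura 2020 Lemma 6.16) times ONE
symbol — a `3`-adic unit because `c, d ≡ 2 (mod 3)`; the Euler product is `(q + 1 − a_q)/q`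
(`a₃(f) = 0` as `9 ∣ N`, Atkin–Lehner).  Two theorems: the row-level reduction
`certSupply_row_of_unitMinusSymbol`, and the class-level one `certSupply_of_forall_unitMinusSymbol`
whose conclusion is LITERALLY the hypothesis (C2) of
`KimAtThreeKolyvaginPortShared.katoKuriharaPortThreeShared_of_fineKato_of_certSupply_of_anomalousRows`.
What remains displayed class-wide is therefore (C2′): «on every row, the minus modular symbol of
`f` is a `3`-adic unit at SOME cusp `a₀/q^n` with `q ≡ 2 (mod 3)`, `q ∤ N`, `3 ∤ #Ẽ(𝔽_q)`» — per
row a finite computation; class-wide an Ash–Stevens-type non-vanishing statement (Duke 53 (1986)),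
not in the tree.  Nothing is booked; 19560 stays open.
References: [Kato2004Asterisque] Thm. 6.6 (1), Ex. 13.3; [Rubin1998ESMEC] Cor. 7.2;
[KimKimSun2020] Def. 7.1, Thm. 7.3; [KimNakamura2020] Lemma 6.16; [AtkinLehner1970] Thm. 3.
-/

noncomputable section

set_option linter.dupNamespace false

open scoped NumberField TensorProduct Classical
open Field Finset IsDedekindDomain NumberField WeierstrassCurve Rat.HeightOneSpectrum
open Literature.NumberTheory.GaloisRepresentations Literature.NumberTheory.GaloisCohomology
open Literature.NumberTheory.GaloisRepresentations.DiscreteGaloisModule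
open Literature.NumberTheory.EllipticCurves Literature.NumberTheory.EllipticCurves.ModularForms
open Literature.NumberTheory.EllipticCurves.Rank1Residual
open Literature.NumberTheory.EllipticCurves.Kato2004
open Literature.NumberTheory.EllipticCurves.Kato2004.EulerSystemValues
open Summit.BirchSwinnertonDyer.Rank1Residual.GaloisImage

namespace Summit.BirchSwinnertonDyer.BirchSwinnertonDyer.Theorems.KimAtThreeKolyvaginPortSharedCert

/-! ### §1. Arithmetic helpers -/

/-- `3 ∤ A² + 1` for `3 ∤ A` (`A² ≡ 1 (mod 3)`). [folklore] -/
theorem not_three_dvd_sq_add_one {A : ℕ} (hA : ¬ 3 ∣ A) : ¬ 3 ∣ A ^ 2 + 1 := by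
  intro h
  set k := A / 3 with hk0
  rcases (show A = 3 * k + 1 ∨ A = 3 * k + 2 by omega) with hk | hk
  · rw [hk, show (3 * k + 1) ^ 2 + 1 = 3 * (3 * k ^ 2 + 2 * k) + 2 by ring] at h
    have := (Nat.dvd_add_right (dvd_mul_right 3 _)).mp h
    omega
  · rw [hk, show (3 * k + 2) ^ 2 + 1 = 3 * (3 * k ^ 2 + 4 * k + 1) + 2 by ring] at h
    have := (Nat.dvd_add_right (dvd_mul_right 3 _)).mp h
    omega

/-- `3 ∣ A² − 1` for `3 ∤ A`. [folklore] -/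
theorem three_dvd_sq_sub_one {A : ℕ} (hA : ¬ 3 ∣ A) : (3 : ℤ) ∣ (A : ℤ) ^ 2 - 1 := by
  set k := A / 3 with hk0
  rcases (show A = 3 * k + 1 ∨ A = 3 * k + 2 by omega) with hk | hk
  · exact ⟨3 * k ^ 2 + 2 * k, by rw [hk]; push_cast; ring⟩
  · exact ⟨3 * k ^ 2 + 4 * k + 1, by rw [hk]; push_cast; ring⟩

/-- **Dirichlet's theorem in the progression `1 + A² (mod 3A)`**: for `3 ∤ A` and any bound `B`
there is a prime `c > B` with `c ≡ 1 (mod A)` and `c ≡ 2 (mod 3)` (Mathlib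
`Nat.forall_exists_prime_gt_and_zmodEq`; `1 + A²` is prime to `A` and `≡ 2 (mod 3)`).
[folklore] -/
theorem exists_prime_gt_modEq_one_modEq_two {A : ℕ} (hA0 : 0 < A) (hA : ¬ 3 ∣ A) (B : ℕ) :
    ∃ c : ℕ, B < c ∧ c.Prime ∧ (c : ℤ) ≡ 1 [ZMOD (A : ℤ)] ∧ (c : ℤ) ≡ 2 [ZMOD 3] := by
  have hcop : IsCoprime ((1 + (A : ℤ) ^ 2 : ℤ)) ((3 * A : ℕ) : ℤ) := by
    rw [Int.isCoprime_iff_gcd_eq_one, Int.gcd_eq_natAbs]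
    have h1 : ((1 + (A : ℤ) ^ 2 : ℤ)).natAbs = A ^ 2 + 1 := by
      rw [show (1 + (A : ℤ) ^ 2 : ℤ) = ((A ^ 2 + 1 : ℕ) : ℤ) by push_cast; ring, Int.natAbs_natCast]
    rw [h1, Int.natAbs_natCast]
    apply Nat.Coprime.mul_right
    · exact Nat.coprime_comm.mp ((Nat.Prime.coprime_iff_not_dvd Nat.prime_three).mpr
        (not_three_dvd_sq_add_one hA))
    · rw [show A ^ 2 + 1 = 1 + A * A by ring]
      exact (Nat.coprime_add_mul_left_left 1 A A).mpr (Nat.coprime_one_left A)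
  obtain ⟨c, hcB, hcp, hc⟩ :=
    Nat.forall_exists_prime_gt_and_zmodEq B (q := 3 * A) (by positivity) hcop
  refine ⟨c, hcB, hcp, ?_, ?_⟩
  · -- `c ≡ 1 + A² ≡ 1 (mod A)`
    have hA3 : (A : ℤ) ∣ ((3 * A : ℕ) : ℤ) := ⟨3, by push_cast; ring⟩
    exact (hc.of_dvd hA3).trans (Int.modEq_iff_dvd.mpr ⟨-(A : ℤ), by ring⟩)
  · -- `c ≡ 1 + A² ≡ 2 (mod 3)`
    have h33 : (3 : ℤ) ∣ ((3 * A : ℕ) : ℤ) := ⟨A, by push_cast; ring⟩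
    refine (hc.of_dvd h33).trans (Int.modEq_iff_dvd.mpr ?_)
    rw [show (2 : ℤ) - (1 + (A : ℤ) ^ 2) = -((A : ℤ) ^ 2 - 1) by ring]
    exact (dvd_neg).mpr (three_dvd_sq_sub_one hA)

/-- A prime above `m > 0` is prime to `m`, in `Int.gcd` currency. [folklore] -/
theorem int_gcd_natCast_eq_one_of_prime_of_lt {c m : ℕ} (hc : c.Prime) (hm0 : 0 < m) (hm : m < c) :
    Int.gcd (c : ℤ) (m : ℤ) = 1 := by
  rw [Int.gcd_natCast_natCast]
  exact (Nat.Prime.coprime_iff_not_dvd hc).mpr (Nat.not_dvd_of_pos_of_lt hm0 hm)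

/-! ### §2. The row-level reduction: ONE unit minus symbol ⟹ Kato's auxiliary datum with unit
value certificates -/

/-- **(C2) at a row from ONE unit minus modular symbol.**  For the newform `P.f` of a
parametrisation datum of `W` at a level `N` with `9 ∣ N` (additive `3`): a prime `q ≡ 2 (mod 3)`
with `q ∤ N` and `3 ∤ q + 1 − a_q(f)` (non-anomalous), an exponent `n ≥ 1` and a numerator `a₀`
with `[a₀/q^n]⁻_f` a non-zero `3`-adic unit yield Kato's auxiliary cusp datum `(c, d, a, A, d′, aM)`
with EVERY guard and BOTH value certificates of ★ PK-6₂ ∘ T-PK6-VDIS: `A = q^n`, `a = a₀`,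
`d′ = 1`, `aM = (q ↦ a_q, else 0)`, and `c`, `d` primes `≡ 1 (mod A)`, `≡ 2 (mod 3)`, `> 18AN`
(Dirichlet); the four-term minus-symbol factor collapses by periodicity to
`cd(c − 1)(d − 1)·[a₀/A]⁻` (Kato's factor of Rubin 1998 Cor. 7.2 / Kim–Kim–Sun 2020 Thm. 7.3) and
the Euler product to `(q + 1 − a_q)/q` (`a₃(f) = 0`, Atkin–Lehner).
[cite: Kato2004Asterisque, Thm. 6.6 (1) (p. 163) and Ex. 13.3 (pp. 224–225)]
[cite: AtkinLehner1970, Thm. 3] -/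
theorem certSupply_row_of_unitMinusSymbol
    (W : WeierstrassCurve ℚ) [W.IsElliptic] {N : ℕ} [NeZero N] (P : ModularParametrizationData W N)
    (h9 : 3 ^ 2 ∣ N)
    {q n : ℕ} (hq : q.Prime) (hq3 : q % 3 = 2) (hqN : ¬ q ∣ N) (hn : 1 ≤ n)
    {t : ℤ} (ht : cuspCoeff P.f q = t) (h3t : ¬ (3 : ℤ) ∣ (q : ℤ) + 1 - t)
    {a₀ : ℤ} (hX0 : ratMinusSymbol P.f ((a₀ : ℚ) / ((q ^ n : ℕ) : ℚ)) ≠ 0)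
    (hX : padicValRat 3 (ratMinusSymbol P.f ((a₀ : ℚ) / ((q ^ n : ℕ) : ℚ))) = 0) :
    ∃ (c d a : ℤ) (A : ℕ) (d' : ℤ) (aM : ℕ → ℤ),
      0 < A ∧ Int.gcd c (6 * 3 * A) = 1 ∧ Int.gcd d (6 * 3 * N) = 1 ∧
      (∀ q : ℕ, q.Prime → q ≡ 1 [MOD 3] → ¬ q ∣ 2 * c.natAbs * d.natAbs * A) ∧
      Int.gcd (c * d) A = 1 ∧ d * d' ≡ 1 [ZMOD (A : ℤ)] ∧ Nat.Coprime A N ∧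
      (∀ q ∈ (3 * A).primeFactors, cuspCoeff P.f q = aM q) ∧
      (∏ q ∈ (3 * A).primeFactors,
          (1 - (aM q : ℚ) / q + (if q ∣ N then 0 else (1 / q : ℚ))) ≠ 0) ∧
      padicValRat 3 (∏ q ∈ (3 * A).primeFactors,
          (1 - (aM q : ℚ) / q + (if q ∣ N then 0 else (1 / q : ℚ)))) = 0 ∧
      ((c : ℚ) ^ 2 * (d : ℚ) ^ 2 * ratMinusSymbol P.f ((a : ℚ) / A) -
          (c : ℚ) * (d : ℚ) ^ 2 * ratMinusSymbol P.f ((a * c : ℚ) / A) -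
          (c : ℚ) ^ 2 * (d : ℚ) * ratMinusSymbol P.f ((a * d' : ℚ) / A) +
          (c : ℚ) * (d : ℚ) * ratMinusSymbol P.f ((a * c * d' : ℚ) / A) ≠ 0) ∧
      padicValRat 3 ((c : ℚ) ^ 2 * (d : ℚ) ^ 2 * ratMinusSymbol P.f ((a : ℚ) / A) -
          (c : ℚ) * (d : ℚ) ^ 2 * ratMinusSymbol P.f ((a * c : ℚ) / A) -
          (c : ℚ) ^ 2 * (d : ℚ) * ratMinusSymbol P.f ((a * d' : ℚ) / A) +
          (c : ℚ) * (d : ℚ) * ratMinusSymbol P.f ((a * c * d' : ℚ) / A)) = 0 := by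
  set A : ℕ := q ^ n with hA
  have hA0 : 0 < A := pow_pos hq.pos n
  have hq3' : ¬ 3 ∣ q := by omega
  have hq3ne : q ≠ 3 := by omega
  have hA3 : ¬ 3 ∣ A := fun h => hq3' (Nat.prime_three.dvd_of_dvd_pow h)
  have hN0 : 0 < N := Nat.pos_of_ne_zero (NeZero.ne N)
  -- the auxiliary primes `c`, `d`
  obtain ⟨c, hcB, hcp, hc1, hc2⟩ := exists_prime_gt_modEq_one_modEq_two hA0 hA3 (6 * 3 * A * N)
  obtain ⟨d, hdB, hdp, hd1, hd2⟩ := exists_prime_gt_modEq_one_modEq_two hA0 hA3 (6 * 3 * A * N)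
  have hc3 : c % 3 = 2 := by unfold Int.ModEq at hc2; omega
  have hd3 : d % 3 = 2 := by unfold Int.ModEq at hd2; omega
  have hc0 : (c : ℚ) ≠ 0 := by exact_mod_cast hcp.ne_zero
  have hd0 : (d : ℚ) ≠ 0 := by exact_mod_cast hdp.ne_zero
  have hc1' : (c : ℚ) - 1 ≠ 0 := sub_ne_zero.mpr (by exact_mod_cast hcp.one_lt.ne')
  have hd1' : (d : ℚ) - 1 ≠ 0 := sub_ne_zero.mpr (by exact_mod_cast hdp.one_lt.ne')
  have hAQ : (A : ℚ) ≠ 0 := by exact_mod_cast hA0.ne'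
  -- the symbol and its translates
  set X₁ := ratMinusSymbol P.f ((a₀ : ℚ) / (A : ℚ)) with hX₁
  obtain ⟨k, hk⟩ := hc1.symm.dvd
  have hcq : (c : ℚ) = (A : ℚ) * (k : ℚ) + 1 := by
    have : (c : ℤ) = (A : ℤ) * k + 1 := by linarith
    exact_mod_cast this
  have hX2 : ratMinusSymbol P.f (((a₀ : ℤ) : ℚ) * ((c : ℤ) : ℚ) / (A : ℚ)) = X₁ := by
    have : ((a₀ : ℤ) : ℚ) * ((c : ℤ) : ℚ) / (A : ℚ) = (a₀ : ℚ) / (A : ℚ) + ((a₀ * k : ℤ) : ℚ) := by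
      push_cast
      rw [hcq]
      field_simp
      ring
    rw [this, ratMinusSymbol_add_intCast]
  have hX3 : ratMinusSymbol P.f (((a₀ : ℤ) : ℚ) * ((1 : ℤ) : ℚ) / (A : ℚ)) = X₁ := by
    rw [Int.cast_one, mul_one]
  have hX4 : ratMinusSymbol P.f (((a₀ : ℤ) : ℚ) * ((c : ℤ) : ℚ) * ((1 : ℤ) : ℚ) / (A : ℚ)) = X₁ := by
    rw [Int.cast_one, mul_one, hX2]
  -- the four-term factor collapses
  have hR : ((c : ℤ) : ℚ) ^ 2 * ((d : ℤ) : ℚ) ^ 2 * ratMinusSymbol P.f (((a₀ : ℤ) : ℚ) / (A : ℚ)) -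
      ((c : ℤ) : ℚ) * ((d : ℤ) : ℚ) ^ 2 * ratMinusSymbol P.f (((a₀ : ℤ) : ℚ) * ((c : ℤ) : ℚ) / (A : ℚ)) -
      ((c : ℤ) : ℚ) ^ 2 * ((d : ℤ) : ℚ) * ratMinusSymbol P.f (((a₀ : ℤ) : ℚ) * ((1 : ℤ) : ℚ) / (A : ℚ)) +
      ((c : ℤ) : ℚ) * ((d : ℤ) : ℚ) *
        ratMinusSymbol P.f (((a₀ : ℤ) : ℚ) * ((c : ℤ) : ℚ) * ((1 : ℤ) : ℚ) / (A : ℚ)) =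
      (c : ℚ) * (d : ℚ) * ((c : ℚ) - 1) * ((d : ℚ) - 1) * X₁ := by
    rw [hX2, hX3, hX4]
    push_cast
    ring
  have hRne : (c : ℚ) * (d : ℚ) * ((c : ℚ) - 1) * ((d : ℚ) - 1) * X₁ ≠ 0 :=
    mul_ne_zero (mul_ne_zero (mul_ne_zero (mul_ne_zero hc0 hd0) hc1') hd1') hX0
  have hv3c : padicValRat 3 (c : ℚ) = 0 := by
    rw [padicValRat.of_nat]
    exact_mod_cast padicValNat.eq_zero_of_not_dvd (by omega : ¬ 3 ∣ c)
  have hv3d : padicValRat 3 (d : ℚ) = 0 := by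
    rw [padicValRat.of_nat]
    exact_mod_cast padicValNat.eq_zero_of_not_dvd (by omega : ¬ 3 ∣ d)
  have hv3c1 : padicValRat 3 ((c : ℚ) - 1) = 0 := by
    rw [show (c : ℚ) - 1 = (((c : ℤ) - 1 : ℤ) : ℚ) by push_cast; ring, padicValRat.of_int]
    exact_mod_cast padicValInt.eq_zero_of_not_dvd (by omega : ¬ (3 : ℤ) ∣ (c : ℤ) - 1)
  have hv3d1 : padicValRat 3 ((d : ℚ) - 1) = 0 := by
    rw [show (d : ℚ) - 1 = (((d : ℤ) - 1 : ℤ) : ℚ) by push_cast; ring, padicValRat.of_int]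
    exact_mod_cast padicValInt.eq_zero_of_not_dvd (by omega : ¬ (3 : ℤ) ∣ (d : ℤ) - 1)
  have hRval : padicValRat 3 ((c : ℚ) * (d : ℚ) * ((c : ℚ) - 1) * ((d : ℚ) - 1) * X₁) = 0 := by
    rw [padicValRat.mul (mul_ne_zero (mul_ne_zero (mul_ne_zero hc0 hd0) hc1') hd1') hX0,
      padicValRat.mul (mul_ne_zero (mul_ne_zero hc0 hd0) hc1') hd1',
      padicValRat.mul (mul_ne_zero hc0 hd0) hc1', padicValRat.mul hc0 hd0,
      hv3c, hv3d, hv3c1, hv3d1, hX]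
    norm_num
  -- the prime factors of `3A`
  have hpf : (3 * A).primeFactors = {3, q} := by
    rw [Nat.primeFactors_mul (by norm_num) hA0.ne', Nat.Prime.primeFactors Nat.prime_three, hA,
      Nat.primeFactors_prime_pow (by omega) hq, ← Finset.insert_eq]
  have h3q : (3 : ℕ) ≠ q := fun h => hq3ne h.symm
  have h3N : 3 ∣ N := dvd_trans (dvd_pow_self 3 two_ne_zero) h9
  have ha3 : cuspCoeff P.f 3 = 0 := P.isNewformOf.1.cuspCoeff_eq_zero_of_sq_dvd Nat.prime_three h9
  -- the Euler product
  set aM : ℕ → ℤ := fun m => if m = q then t else 0 with haM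
  have haM3 : aM 3 = 0 := by rw [haM]; simp [hq3ne.symm]
  have haMq : aM q = t := by rw [haM]; simp
  have hnum : ((q : ℤ) + 1 - t : ℤ) ≠ 0 := fun h => h3t (h ▸ dvd_zero 3)
  have hprod : ∏ m ∈ (3 * A).primeFactors,
      (1 - (aM m : ℚ) / m + (if m ∣ N then 0 else (1 / m : ℚ))) =
        (((q : ℤ) + 1 - t : ℤ) : ℚ) / (q : ℚ) := by
    rw [hpf, Finset.prod_pair h3q, haM3, haMq, if_pos h3N, if_neg hqN]
    have hq0 : (q : ℚ) ≠ 0 := by exact_mod_cast hq.ne_zero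
    push_cast
    field_simp
    ring
  refine ⟨c, d, a₀, A, 1, aM, hA0, ?_, ?_, ?_, ?_, ?_, ?_, ?_, ?_, ?_, ?_, ?_⟩
  · -- `(c, 18A) = 1`
    rw [show (6 * 3 * (A : ℤ) : ℤ) = ((6 * 3 * A : ℕ) : ℤ) by push_cast; ring]
    exact int_gcd_natCast_eq_one_of_prime_of_lt hcp (by positivity) (by nlinarith)
  · -- `(d, 18N) = 1`
    rw [show (6 * 3 * (N : ℤ) : ℤ) = ((6 * 3 * N : ℕ) : ℤ) by push_cast; ring]
    exact int_gcd_natCast_eq_one_of_prime_of_lt hdp (by positivity) (by nlinarith)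
  · -- `hcdA`: the primes dividing `2cdA` are `2, c, d, q`, none `≡ 1 (mod 3)`
    intro r hr hr1 hdvd
    rw [Int.natAbs_natCast, Int.natAbs_natCast] at hdvd
    have hr3 : r % 3 = 1 := hr1
    rcases (Nat.Prime.dvd_mul hr).mp hdvd with h | h
    · rcases (Nat.Prime.dvd_mul hr).mp h with h | h
      · rcases (Nat.Prime.dvd_mul hr).mp h with h | h
        · have := (Nat.prime_dvd_prime_iff_eq hr Nat.prime_two).mp h; omega
        · have := (Nat.prime_dvd_prime_iff_eq hr hcp).mp h; omega
      · have := (Nat.prime_dvd_prime_iff_eq hr hdp).mp h; omega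
    · have := (Nat.prime_dvd_prime_iff_eq hr hq).mp (hr.dvd_of_dvd_pow h); omega
  · -- `(cd, A) = 1`
    obtain ⟨k', hk'⟩ := (hc1.mul hd1).symm.dvd
    refine Int.isCoprime_iff_gcd_eq_one.mp ⟨1, -k', ?_⟩
    linear_combination hk'
  · -- `d · 1 ≡ 1 (mod A)`
    simpa using hd1
  · -- `(A, N) = 1`
    exact Nat.Coprime.pow_left n ((Nat.Prime.coprime_iff_not_dvd hq).mpr hqN)
  · -- integer models of `a_3(f) = 0` and `a_q(f) = t`
    intro m hm
    rw [hpf, Finset.mem_insert, Finset.mem_singleton] at hm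
    rcases hm with rfl | rfl
    · rw [ha3, haM3]; push_cast; rfl
    · rw [ht, haMq]
  · -- Euler product non-zero
    rw [hprod]
    exact div_ne_zero (by exact_mod_cast hnum) (by exact_mod_cast hq.ne_zero)
  · -- Euler product a `3`-unit
    rw [hprod, padicValRat.div (by exact_mod_cast hnum) (by exact_mod_cast hq.ne_zero),
      padicValRat.of_int, padicValRat.of_nat, padicValInt.eq_zero_of_not_dvd h3t,
      padicValNat.eq_zero_of_not_dvd hq3']
    norm_num
  · -- `R⁻ ≠ 0`
    rw [hR]; exact hRne
  · -- `R⁻` a `3`-unit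
    rw [hR]; exact hRval

/-! ### §3. Class level: the displayed (C2) of `KimAtThreeKolyvaginPortShared` from ONE unit minus
symbol per row (C2′), and the crux BY NAME from (C1) + (C2′) + (C3) -/

/-- **(C2) from (C2′).**  If every row of the crux `KatoKuriharaPortThreeShared` (tower-surjective
`W`, additive `3`, `3 ∤ c₃`, `E(ℚ₃)[3] = 0`, lattice-optimal datum `P` at conductor level, `3 ∤`
Manin constant) carries ONE certificate (C2′) — a prime `q ≡ 2 (mod 3)`, `q ∤ N`, non-anomalous
(`3 ∤ q + 1 − a_q(f)`), `n ≥ 1`, `a₀` with `[a₀/q^n]⁻_f` a non-zero `3`-adic unit — then the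
certificate supply (C2) of
`KimAtThreeKolyvaginPortShared.katoKuriharaPortThreeShared_of_fineKato_of_certSupply_of_anomalousRows`
holds VERBATIM (`9 ∣ N` from `Addv` and `N = N_W`, then `certSupply_row_of_unitMinusSymbol`).
[cite: Kato2004Asterisque, Thm. 6.6 (1) (p. 163) and Ex. 13.3 (pp. 224–225)] -/
theorem certSupply_of_forall_unitMinusSymbol
    (hC2' : ∀ (W : WeierstrassCurve ℚ) [W.IsElliptic] [W.IsGloballyMinimal],
      (∀ m : ℕ, W.HasSurjectiveModNGaloisRep (3 ^ m : ℕ)) →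
      (haveI : Fact (Nat.Prime 3) := ⟨Nat.prime_three⟩; Addv W 3) →
      ¬ 3 ∣ (W.baseChange ℚ_[3]).localTamagawaNumber ℤ_[3] →
      Nat.card {Q : (W.baseChange ℚ_[3]).toAffine.Point // (3 : ℕ) • Q = 0} = 1 →
      ∀ {N : ℕ} [NeZero N] (P : ModularParametrizationData W N), N = W.conductorNorm ℤ →
        (∀ z ∈ P.L.lattice, ∃ w ∈ periodLattice P.f, z = P.c * w) →
        ¬ (3 : ℤ) ∣ P.maninConstant →
        ∃ (q n : ℕ) (t a₀ : ℤ), q.Prime ∧ q % 3 = 2 ∧ ¬ q ∣ N ∧ 1 ≤ n ∧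
          cuspCoeff P.f q = t ∧ ¬ (3 : ℤ) ∣ (q : ℤ) + 1 - t ∧
          ratMinusSymbol P.f ((a₀ : ℚ) / ((q ^ n : ℕ) : ℚ)) ≠ 0 ∧
          padicValRat 3 (ratMinusSymbol P.f ((a₀ : ℚ) / ((q ^ n : ℕ) : ℚ))) = 0) :
    ∀ (W : WeierstrassCurve ℚ) [W.IsElliptic] [W.IsGloballyMinimal],
      (∀ m : ℕ, W.HasSurjectiveModNGaloisRep (3 ^ m : ℕ)) →
      (haveI : Fact (Nat.Prime 3) := ⟨Nat.prime_three⟩; Addv W 3) →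
      ¬ 3 ∣ (W.baseChange ℚ_[3]).localTamagawaNumber ℤ_[3] →
      Nat.card {Q : (W.baseChange ℚ_[3]).toAffine.Point // (3 : ℕ) • Q = 0} = 1 →
      ∀ {N : ℕ} [NeZero N] (P : ModularParametrizationData W N), N = W.conductorNorm ℤ →
        (∀ z ∈ P.L.lattice, ∃ w ∈ periodLattice P.f, z = P.c * w) →
        ¬ (3 : ℤ) ∣ P.maninConstant →
        ∃ (c d a : ℤ) (A : ℕ) (d' : ℤ) (aM : ℕ → ℤ),
          0 < A ∧ Int.gcd c (6 * 3 * A) = 1 ∧ Int.gcd d (6 * 3 * N) = 1 ∧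
          (∀ q : ℕ, q.Prime → q ≡ 1 [MOD 3] → ¬ q ∣ 2 * c.natAbs * d.natAbs * A) ∧
          Int.gcd (c * d) A = 1 ∧ d * d' ≡ 1 [ZMOD (A : ℤ)] ∧ Nat.Coprime A N ∧
          (∀ q ∈ (3 * A).primeFactors, cuspCoeff P.f q = aM q) ∧
          (∏ q ∈ (3 * A).primeFactors,
              (1 - (aM q : ℚ) / q + (if q ∣ N then 0 else (1 / q : ℚ))) ≠ 0) ∧
          padicValRat 3 (∏ q ∈ (3 * A).primeFactors,
              (1 - (aM q : ℚ) / q + (if q ∣ N then 0 else (1 / q : ℚ)))) = 0 ∧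
          ((c : ℚ) ^ 2 * (d : ℚ) ^ 2 * ratMinusSymbol P.f ((a : ℚ) / A) -
              (c : ℚ) * (d : ℚ) ^ 2 * ratMinusSymbol P.f ((a * c : ℚ) / A) -
              (c : ℚ) ^ 2 * (d : ℚ) * ratMinusSymbol P.f ((a * d' : ℚ) / A) +
              (c : ℚ) * (d : ℚ) * ratMinusSymbol P.f ((a * c * d' : ℚ) / A) ≠ 0) ∧
          padicValRat 3 ((c : ℚ) ^ 2 * (d : ℚ) ^ 2 * ratMinusSymbol P.f ((a : ℚ) / A) -
              (c : ℚ) * (d : ℚ) ^ 2 * ratMinusSymbol P.f ((a * c : ℚ) / A) -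
              (c : ℚ) ^ 2 * (d : ℚ) * ratMinusSymbol P.f ((a * d' : ℚ) / A) +
              (c : ℚ) * (d : ℚ) * ratMinusSymbol P.f ((a * c * d' : ℚ) / A)) = 0 := by
  intro W _ _ htow hadd hc3 ht N _ P hN hlat hman
  obtain ⟨q, n, t, a₀, hq, hq3, hqN, hn, hat, h3t, hX0, hX⟩ := hC2' W htow hadd hc3 ht P hN hlat hman
  have h9 : 3 ^ 2 ∣ N := hN ▸ KimAtThreeKolyvaginPortShared.sq_dvd_conductorNorm_of_addv W hadd
  exact certSupply_row_of_unitMinusSymbol W P h9 hq hq3 hqN hn hat h3t hX0 hX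

/-- **Crux `KatoKuriharaPortThreeShared` (stmt-BirchSwinnertonDyer-19560) BY NAME from (C1) the fine
Kato package, (C2′) ONE unit minus modular symbol per row, (C3) the anomalous-bad-place rows** —
`KimAtThreeKolyvaginPortShared.katoKuriharaPortThreeShared_of_fineKato_of_certSupply_of_anomalousRows`
with its (C2) fed by `certSupply_of_forall_unitMinusSymbol`.  Nothing is booked; the three inputs
stay displayed (kim3 memo KIM3-W2-PORT-g10.md).
[cite: Kato2004Asterisque, (8.1.3) (p. 180), Prop. 8.12 (p. 186), §9.4 and Thm. 9.7 (pp. 188–189), Thm. 6.6 (1) (p. 163), Ex. 13.3 (pp. 224–225)]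
[cite: Kim2022StructureSelmer, Thm. 3.13 and §3.3–§3.4.1] [cite: MazurRubin2004, Thm. 3.2.4 and App. A] -/
theorem katoKuriharaPortThreeShared_of_fineKato_of_unitMinusSymbols_of_anomalousRows
    (hC1 : ∀ (W : WeierstrassCurve ℚ) [W.IsElliptic] [W.IsGloballyMinimal]
      [ContinuousSMul ℤ_[3] (W.tateModule 3)] [Module.Free ℤ_[3] (W.tateModule 3)]
      [Module.Finite ℤ_[3] (W.tateModule 3)],
      (∀ m : ℕ, W.HasSurjectiveModNGaloisRep (3 ^ m : ℕ)) →
      (haveI : Fact (Nat.Prime 3) := ⟨Nat.prime_three⟩; Addv W 3) →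
      ¬ 3 ∣ (W.baseChange ℚ_[3]).localTamagawaNumber ℤ_[3] →
      Nat.card {Q : (W.baseChange ℚ_[3]).toAffine.Point // (3 : ℕ) • Q = 0} = 1 →
      ∀ (v₃ : HeightOneSpectrum (𝓞 ℚ)), ((3 : ℕ) : 𝓞 ℚ) ∈ v₃.asIdeal →
      ∀ {N : ℕ} [NeZero N] (P : ModularParametrizationData W N), N = W.conductorNorm ℤ →
        (∀ z ∈ P.L.lattice, ∃ w ∈ periodLattice P.f, z = P.c * w) →
        ¬ (3 : ℤ) ∣ P.maninConstant →
        ∃ (ι : (n : ℕ) → (CyclotomicField n ℚ →+* ℂ)) (κK : ℝ)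
          (Λ : ∀ (k' : ℕ) (r : Finset (HeightOneSpectrum (𝓞 ℚ))),
            H1 (tateRep W 3) (cycSubgroup 3 k' r) →ₗ[ℤ_[3]]
              ℚ_[3] ⊗[ℚ] CyclotomicField (cycLevel 3 k' r) ℚ)
          (Λfin : ∀ j : ℕ, galoisCohomology
            ((W.torsionGaloisModule (((3 : ℕ) : ℤ) ^ j * ((3 : ℕ) : ℤ))).toLocal (Sum.inr v₃)) 1 →+
              ZMod (3 ^ (j + 1))),
          κK ≠ 0 ∧ (∃ u : ℚ, (u : ℝ) = κK ∧ padicValRat 3 u = 0) ∧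
          (∀ j : ℕ, KatoExpStarFiniteLevelAt W 3 j 0 v₃ Λ (Λfin j)) ∧
          ∀ (c d a : ℤ) (A : ℕ), 0 < A → Int.gcd c (6 * 3 * A) = 1 → Int.gcd d (6 * 3 * N) = 1 →
            ∃ (z : ∀ (k' : ℕ) (r : (cyclotomicLevelsRat 3 (badPlaces c d A N)).Ideals),
                  H1 (tateRep W 3) ((cyclotomicLevelsRat 3 (badPlaces c d A N)).level k' r.1))
              (x : ∀ (k' : ℕ) (r : (cyclotomicLevelsRat 3 (badPlaces c d A N)).Ideals),
                  CyclotomicField (cycLevel 3 k' r.1) ℚ),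
              ZetaBody W 3 P.f ι κK Λ c d a A z x)
    (hC2' : ∀ (W : WeierstrassCurve ℚ) [W.IsElliptic] [W.IsGloballyMinimal],
      (∀ m : ℕ, W.HasSurjectiveModNGaloisRep (3 ^ m : ℕ)) →
      (haveI : Fact (Nat.Prime 3) := ⟨Nat.prime_three⟩; Addv W 3) →
      ¬ 3 ∣ (W.baseChange ℚ_[3]).localTamagawaNumber ℤ_[3] →
      Nat.card {Q : (W.baseChange ℚ_[3]).toAffine.Point // (3 : ℕ) • Q = 0} = 1 →
      ∀ {N : ℕ} [NeZero N] (P : ModularParametrizationData W N), N = W.conductorNorm ℤ →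
        (∀ z ∈ P.L.lattice, ∃ w ∈ periodLattice P.f, z = P.c * w) →
        ¬ (3 : ℤ) ∣ P.maninConstant →
        ∃ (q n : ℕ) (t a₀ : ℤ), q.Prime ∧ q % 3 = 2 ∧ ¬ q ∣ N ∧ 1 ≤ n ∧
          cuspCoeff P.f q = t ∧ ¬ (3 : ℤ) ∣ (q : ℤ) + 1 - t ∧
          ratMinusSymbol P.f ((a₀ : ℚ) / ((q ^ n : ℕ) : ℚ)) ≠ 0 ∧
          padicValRat 3 (ratMinusSymbol P.f ((a₀ : ℚ) / ((q ^ n : ℕ) : ℚ))) = 0)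
    (hC3 : ∀ (W : WeierstrassCurve ℚ) [W.IsElliptic] [W.IsGloballyMinimal],
      (∀ m : ℕ, W.HasSurjectiveModNGaloisRep (3 ^ m : ℕ)) →
      (haveI : Fact (Nat.Prime 3) := ⟨Nat.prime_three⟩; Addv W 3) →
      ¬ 3 ∣ (W.baseChange ℚ_[3]).localTamagawaNumber ℤ_[3] →
      Nat.card {Q : (W.baseChange ℚ_[3]).toAffine.Point // (3 : ℕ) • Q = 0} = 1 →
      ∀ (v₃ : HeightOneSpectrum (𝓞 ℚ)), ((3 : ℕ) : 𝓞 ℚ) ∈ v₃.asIdeal →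
      ∀ (η : (q : HeightOneSpectrum (𝓞 ℚ)) → (ZMod (Ideal.absNorm q.asIdeal))ˣ),
        (∀ q, Subgroup.zpowers (η q) = ⊤) →
      ∀ {N : ℕ} [NeZero N] (P : ModularParametrizationData W N), N = W.conductorNorm ℤ →
        (∀ z ∈ P.L.lattice, ∃ w ∈ periodLattice P.f, z = P.c * w) →
        ¬ (3 : ℤ) ∣ P.maninConstant →
        -- the row HAS an anomalous bad place `w ≠ 3`
        (∃ w : HeightOneSpectrum (𝓞 ℚ), ¬ W.HasGoodReductionAt w ∧
          ((primesEquiv w : Nat.Primes) : ℕ) ≠ 3 ∧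
          ∃ Q : (W.baseChange (w.adicCompletion ℚ)).toAffine.Point, 3 • Q = 0 ∧ Q ≠ 0) →
        KatoKuriharaPortThreeAtWith₂ W 0 v₃ η P) :
    Summit.BirchSwinnertonDyer.BirchSwinnertonDyer.Theses.KimAtThreeKolyvagin.KatoKuriharaPortThreeShared :=
  KimAtThreeKolyvaginPortShared.katoKuriharaPortThreeShared_of_fineKato_of_certSupply_of_anomalousRows
    hC1 (certSupply_of_forall_unitMinusSymbol hC2') hC3

end Summit.BirchSwinnertonDyer.BirchSwinnertonDyer.Theorems.KimAtThreeKolyvaginPortSharedCert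

end
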